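import Summits.Ventures.Crystal3D.Theorems.StickyWulffConstantNoReconstructionGainCubeLayerCover
import Summits.Ventures.Crystal3D.Theorems.StickyWulffConstantNoReconstructionGainLowCoordGeom
import HarnessLib

/-!
# Geometry of the `(100)` slab sample for the cube-facet adhesion rungs

HONEST FRAMING. Part of the venture `Summits/Ventures/Crystal3D` (cell `crystal3d-full`), helper
`--supports` the crux `NoReconstructionGain` (stmt-Ventures-19144, route
`route-Ventures-StickyWulffConstant`).  The `(100)` companion of `…LowCoordGeom.lean`: the slab
sample at `ν = ν₁₀₀ = (√2/2, √6/6, −√3/3)` with `R = 4` is `P` = all sites of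
`Λ₀ = fccStacking 1 √(2/3)` with `−8 ≤ η ≤ −4` (`η = ⟪·, ν₁₀₀⟫`) and lateral radius `≤ ρ`, i.e.
the six complete SQUARE layers `i + j = s`, `s = −11, …, −6`, at heights `s c` (`c = √2/2`, the
`(100)` spacing and hollow height).  Slab potential `Φ(y) = max (η + 6c, −11c − η, 0)`.

* `card_cubeSteepPartners_le_four` — a ball has at most FOUR partners `x` with
  `Φ x − Φ q ≤ −c` (45° cap along `ν₁₀₀`, `card_cap45_le_four`).
* `cubeRim_of_lowPotential_partner` — a non-sample ball `q` with `Φ q < c` touches only RIM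
  sites (lateral radius `> ρ − 2`): covering radius `1/√2` of each square layer
  (`…CubeLayerCover.lean`) gives hollow heights `≥ c` over the disc interior and no room inside
  the slab.

WHAT THIS IS NOT: the rung itself; rung F-C1 not moved.
-/

noncomputable section

namespace Summit.Ventures.Crystal3D.Theorems

open Summit.Ventures.Crystal3D Finset Real
open Literature.MathematicalPhysics.StatisticalMechanics (barlowPos barlowStacking fccStacking
  constHagg barlowPos_mem)
open scoped InnerProductSpace

/-- `c = √2/2`: `c² = 1/2`, `7/10 ≤ c ≤ 8/11`. -/
theorem sqrt_two_half_bounds :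
    (Real.sqrt 2 / 2) ^ 2 = 1 / 2 ∧ (7 : ℝ) / 10 ≤ Real.sqrt 2 / 2 ∧ Real.sqrt 2 / 2 ≤ 8 / 11 := by
  have h2 : (Real.sqrt 2 / 2) ^ 2 = 1 / 2 := by rw [div_pow, Real.sq_sqrt (by norm_num)]; norm_num
  have h0 : 0 ≤ Real.sqrt 2 / 2 := by positivity
  refine ⟨h2, ?_, ?_⟩
  · exact (pow_le_pow_iff_left₀ (by norm_num) h0 two_ne_zero).1 (by rw [h2]; norm_num)
  · exact (pow_le_pow_iff_left₀ h0 (by norm_num) two_ne_zero).1 (by rw [h2]; norm_num)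

/-- **At most four steep partners along the cube normal.**  `X` a unit packing, `q` any point,
`Φ(y) = max (η y + 6c) (max (−11c − η y) 0)` with `η = ⟪·, ν₁₀₀⟫`, `c = √2/2`: at most four
`x ∈ X` touch `q` with `Φ x − Φ q ≤ −c`. -/
theorem card_cubeSteepPartners_le_four (X : Finset (EuclideanSpace ℝ (Fin 3)))
    (hX : ∀ p ∈ X, ∀ q ∈ X, p ≠ q → 1 ≤ dist p q) (q : EuclideanSpace ℝ (Fin 3))
    (Φ : EuclideanSpace ℝ (Fin 3) → ℝ)
    (hΦ : ∀ y, Φ y = max (⟪y, (!₂[Real.sqrt 2 / 2, Real.sqrt 6 / 6, -(Real.sqrt 3 / 3)] :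
        EuclideanSpace ℝ (Fin 3))⟫_ℝ + 6 * (Real.sqrt 2 / 2))
      (max (-(11 * (Real.sqrt 2 / 2)) - ⟪y, (!₂[Real.sqrt 2 / 2, Real.sqrt 6 / 6, -(Real.sqrt 3 / 3)] :
        EuclideanSpace ℝ (Fin 3))⟫_ℝ) 0)) :
    (X.filter fun x => dist q x = 1 ∧ Φ x - Φ q ≤ -(Real.sqrt 2 / 2)).card ≤ 4 := by
  classical
  set ν : EuclideanSpace ℝ (Fin 3) := !₂[Real.sqrt 2 / 2, Real.sqrt 6 / 6, -(Real.sqrt 3 / 3)] with hν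
  have hνn : ‖ν‖ = 1 := norm_cubeNormal
  obtain ⟨hc2, hc7, _⟩ := sqrt_two_half_bounds
  set c : ℝ := Real.sqrt 2 / 2 with hcdef
  set A := X.filter fun x => dist q x = 1 ∧ Φ x - Φ q ≤ -c with hA
  have hΦlo : ∀ y, ⟪y, ν⟫_ℝ + 6 * c ≤ Φ y := fun y => by rw [hΦ]; exact le_max_left _ _
  have hΦlo' : ∀ y, -(11 * c) - ⟪y, ν⟫_ℝ ≤ Φ y := fun y => by
    rw [hΦ]; exact le_trans (le_max_left _ _) (le_max_right _ _)
  have hΦ0 : ∀ y, 0 ≤ Φ y := fun y => by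
    rw [hΦ]; exact le_trans (le_max_right _ _) (le_max_right _ _)
  have hinj : Set.InjOn (fun x : EuclideanSpace ℝ (Fin 3) => x - q) ↑A :=
    fun x _ y _ hxy => sub_left_injective hxy
  have hmemA : ∀ x ∈ A, x ∈ X ∧ dist q x = 1 ∧ Φ x - Φ q ≤ -c := fun x hx => by
    rw [hA, mem_filter] at hx; exact ⟨hx.1, hx.2.1, hx.2.2⟩
  have hunit : ∀ u ∈ A.image (fun x => x - q), ‖u‖ = 1 := by
    intro u hu
    obtain ⟨x, hx, rfl⟩ := mem_image.1 hu
    rw [← dist_eq_norm, dist_comm]; exact (hmemA x hx).2.1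
  have hsep : ∀ u ∈ A.image (fun x => x - q), ∀ w ∈ A.image (fun x => x - q), u ≠ w →
      ⟪u, w⟫_ℝ ≤ 1 / 2 := by
    intro u hu w hw huw
    obtain ⟨x, hx, rfl⟩ := mem_image.1 hu
    obtain ⟨y, hy, rfl⟩ := mem_image.1 hw
    refine inner_le_half_of_one_le_dist (hunit _ hu) (hunit _ hw) ?_
    rw [dist_eq_norm, sub_sub_sub_cancel_right, ← dist_eq_norm]
    exact hX x (hmemA x hx).1 y (hmemA y hy).1 fun hxy => huw (by rw [hxy])
  rw [← card_image_of_injOn hinj]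
  by_cases hup : -(6 * c) < ⟪q, ν⟫_ℝ
  · have hΦq : Φ q = ⟪q, ν⟫_ℝ + 6 * c := by
      rw [hΦ, max_eq_left]
      exact max_le (by linarith) (by linarith)
    refine card_cap45_le_four ν hνn hunit (fun u hu => ?_) hsep
    obtain ⟨x, hx, rfl⟩ := mem_image.1 hu
    have h1 := (hmemA x hx).2.2
    rw [hΦq] at h1
    rw [inner_sub_left]
    linarith [hΦlo x]
  by_cases hdown : ⟪q, ν⟫_ℝ < -(11 * c)
  · have hΦq : Φ q = -(11 * c) - ⟪q, ν⟫_ℝ := by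
      rw [hΦ, max_eq_right_of_lt (by
        calc ⟪q, ν⟫_ℝ + 6 * c < -(11 * c) - ⟪q, ν⟫_ℝ := by linarith
          _ ≤ max (-(11 * c) - ⟪q, ν⟫_ℝ) 0 := le_max_left _ _), max_eq_left (by linarith)]
    refine card_cap45_le_four' ν hνn hunit (fun u hu => ?_) hsep
    obtain ⟨x, hx, rfl⟩ := mem_image.1 hu
    have h1 := (hmemA x hx).2.2
    rw [hΦq] at h1
    rw [inner_sub_left]
    linarith [hΦlo' x]
  · have hΦq : Φ q = 0 := by
      rw [hΦ, max_eq_right (by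
        calc ⟪q, ν⟫_ℝ + 6 * c ≤ 0 := by linarith [not_lt.1 hup]
          _ ≤ max (-(11 * c) - ⟪q, ν⟫_ℝ) 0 := le_max_right _ _),
        max_eq_right (by linarith [not_lt.1 hdown])]
    have hAe : A.image (fun x => x - q) = ∅ := by
      rw [image_eq_empty, eq_empty_iff_forall_notMem]
      intro x hx
      have h1 := (hmemA x hx).2.2
      rw [hΦq, sub_zero] at h1
      linarith [hΦ0 x]
    rw [hAe, card_empty]; norm_num

set_option maxHeartbeats 400000 in
/-- **Low-potential partners touch only rim sites (cube facet).**  `P` = the `(100)` slab sample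
(`R = 4`: all sites with `−8 ≤ η ≤ −4` and `‖p‖² − η² ≤ ρ²`, `ρ ≥ 4`) inside a unit packing `X`;
if `q ∈ X \ P` with `Φ q < c` touches a point `p`, then `‖p‖² − η(p)² > (ρ − 2)²`. -/
theorem cubeRim_of_lowPotential_partner (ρ : ℝ) (hρ : 4 ≤ ρ)
    (X P : Finset (EuclideanSpace ℝ (Fin 3)))
    (hX : ∀ p ∈ X, ∀ q ∈ X, p ≠ q → 1 ≤ dist p q) (hPX : P ⊆ X)
    (hP : ∀ p, p ∈ P ↔ (p ∈ fccStacking 1 (Real.sqrt (2 / 3)) ∧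
      -8 ≤ ⟪p, (!₂[Real.sqrt 2 / 2, Real.sqrt 6 / 6, -(Real.sqrt 3 / 3)] : EuclideanSpace ℝ (Fin 3))⟫_ℝ ∧
      ⟪p, (!₂[Real.sqrt 2 / 2, Real.sqrt 6 / 6, -(Real.sqrt 3 / 3)] : EuclideanSpace ℝ (Fin 3))⟫_ℝ ≤ -4 ∧
      ‖p‖ ^ 2 - ⟪p, (!₂[Real.sqrt 2 / 2, Real.sqrt 6 / 6, -(Real.sqrt 3 / 3)] :
        EuclideanSpace ℝ (Fin 3))⟫_ℝ ^ 2 ≤ ρ ^ 2))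
    (Φ : EuclideanSpace ℝ (Fin 3) → ℝ)
    (hΦ : ∀ y, Φ y = max (⟪y, (!₂[Real.sqrt 2 / 2, Real.sqrt 6 / 6, -(Real.sqrt 3 / 3)] :
        EuclideanSpace ℝ (Fin 3))⟫_ℝ + 6 * (Real.sqrt 2 / 2))
      (max (-(11 * (Real.sqrt 2 / 2)) - ⟪y, (!₂[Real.sqrt 2 / 2, Real.sqrt 6 / 6, -(Real.sqrt 3 / 3)] :
        EuclideanSpace ℝ (Fin 3))⟫_ℝ) 0))
    (p q : EuclideanSpace ℝ (Fin 3)) (hqX : q ∈ X) (hqP : q ∉ P)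
    (hpq : dist p q = 1) (hΦq : Φ q < Real.sqrt 2 / 2) :
    (ρ - 2) ^ 2 < ‖p‖ ^ 2 -
      ⟪p, (!₂[Real.sqrt 2 / 2, Real.sqrt 6 / 6, -(Real.sqrt 3 / 3)] : EuclideanSpace ℝ (Fin 3))⟫_ℝ ^ 2 := by
  set ν : EuclideanSpace ℝ (Fin 3) := !₂[Real.sqrt 2 / 2, Real.sqrt 6 / 6, -(Real.sqrt 3 / 3)] with hν
  set e₁ : EuclideanSpace ℝ (Fin 3) := !₂[1 / 2, -(Real.sqrt 3 / 2), 0] with he₁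
  set e₂ : EuclideanSpace ℝ (Fin 3) := !₂[1 / 2, Real.sqrt 3 / 6, Real.sqrt 6 / 3] with he₂
  obtain ⟨hc2, hc7, hc8⟩ := sqrt_two_half_bounds
  set c : ℝ := Real.sqrt 2 / 2 with hcdef
  have hcpos : 0 < c := by linarith
  -- lateral radius in the cube frame
  have hlat : ∀ v : EuclideanSpace ℝ (Fin 3), ‖v‖ ^ 2 - ⟪v, ν⟫_ℝ ^ 2 = ⟪v, e₁⟫_ℝ ^ 2 + ⟪v, e₂⟫_ℝ ^ 2 := by
    intro v; rw [norm_sq_eq_cubeFrame v]; ring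
  by_contra hle
  have hle : ⟪p, e₁⟫_ℝ ^ 2 + ⟪p, e₂⟫_ℝ ^ 2 ≤ (ρ - 2) ^ 2 := by rw [← hlat]; exact not_lt.1 hle
  -- lateral radius of `q` is at most `ρ - 1`
  have hdq : (⟪q, e₁⟫_ℝ - ⟪p, e₁⟫_ℝ) ^ 2 + (⟪q, e₂⟫_ℝ - ⟪p, e₂⟫_ℝ) ^ 2 ≤ 1 ^ 2 := by
    have hd : ‖q - p‖ ^ 2 = 1 := by rw [← dist_eq_norm, dist_comm, hpq]; norm_num
    rw [norm_sq_eq_cubeFrame (q - p), inner_sub_left, inner_sub_left, inner_sub_left] at hd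
    nlinarith [sq_nonneg (⟪q, ν⟫_ℝ - ⟪p, ν⟫_ℝ)]
  have hlatq : ⟪q, e₁⟫_ℝ ^ 2 + ⟪q, e₂⟫_ℝ ^ 2 ≤ (ρ - 1) ^ 2 := by
    have := planar_sq_add_sq_le (⟪p, e₁⟫_ℝ) (⟪p, e₂⟫_ℝ) (⟪q, e₁⟫_ℝ - ⟪p, e₁⟫_ℝ)
      (⟪q, e₂⟫_ℝ - ⟪p, e₂⟫_ℝ) (ρ - 2) 1 (by linarith) zero_le_one hle hdq
    have e0 : ⟪p, e₁⟫_ℝ + (⟪q, e₁⟫_ℝ - ⟪p, e₁⟫_ℝ) = ⟪q, e₁⟫_ℝ := by ring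
    have e0' : ⟪p, e₂⟫_ℝ + (⟪q, e₂⟫_ℝ - ⟪p, e₂⟫_ℝ) = ⟪q, e₂⟫_ℝ := by ring
    rw [e0, e0', show ρ - 2 + 1 = ρ - 1 by ring] at this
    exact this
  -- a covering site of layer `s ∈ [-11, -6]` near `q` is a sample ball
  have hη : ∀ k i s : ℤ, ⟪barlowPos 1 (Real.sqrt (2 / 3)) constHagg k i (s - i), ν⟫_ℝ = (s : ℝ) * c := by
    intro k i s; rw [hν, inner_barlowPos_cubeNormal]; push_cast; ring
  have hsite : ∀ k i s : ℤ, -11 ≤ s → s ≤ -6 →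
      (⟪q, e₁⟫_ℝ - ⟪barlowPos 1 (Real.sqrt (2 / 3)) constHagg k i (s - i), e₁⟫_ℝ) ^ 2 +
        (⟪q, e₂⟫_ℝ - ⟪barlowPos 1 (Real.sqrt (2 / 3)) constHagg k i (s - i), e₂⟫_ℝ) ^ 2 ≤ 1 / 2 →
      barlowPos 1 (Real.sqrt (2 / 3)) constHagg k i (s - i) ∈ P := by
    intro k i s hs1 hs2 hcov
    set p' := barlowPos 1 (Real.sqrt (2 / 3)) constHagg k i (s - i) with hp'
    rw [hP]
    refine ⟨barlowPos_mem _ _ _, ?_, ?_, ?_⟩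
    · rw [hη]
      have : (-11 : ℝ) ≤ s := by exact_mod_cast hs1
      nlinarith
    · rw [hη]
      have : (s : ℝ) ≤ -6 := by exact_mod_cast hs2
      nlinarith
    · rw [hlat]
      have := planar_sq_add_sq_le (⟪q, e₁⟫_ℝ) (⟪q, e₂⟫_ℝ) (⟪p', e₁⟫_ℝ - ⟪q, e₁⟫_ℝ)
        (⟪p', e₂⟫_ℝ - ⟪q, e₂⟫_ℝ) (ρ - 1) 1 (by linarith) zero_le_one hlatq (by
          have e : (⟪p', e₁⟫_ℝ - ⟪q, e₁⟫_ℝ) ^ 2 + (⟪p', e₂⟫_ℝ - ⟪q, e₂⟫_ℝ) ^ 2 =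
              (⟪q, e₁⟫_ℝ - ⟪p', e₁⟫_ℝ) ^ 2 + (⟪q, e₂⟫_ℝ - ⟪p', e₂⟫_ℝ) ^ 2 := by ring
          rw [e]; linarith)
      have e0 : ⟪q, e₁⟫_ℝ + (⟪p', e₁⟫_ℝ - ⟪q, e₁⟫_ℝ) = ⟪p', e₁⟫_ℝ := by ring
      have e0' : ⟪q, e₂⟫_ℝ + (⟪p', e₂⟫_ℝ - ⟪q, e₂⟫_ℝ) = ⟪p', e₂⟫_ℝ := by ring
      rw [e0, e0', show ρ - 1 + 1 = ρ by ring] at this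
      exact this
  have hfar : ∀ p' ∈ P, 1 ≤ dist q p' := fun p' hp' =>
    hX q hqX p' (hPX hp') fun hqp => hqP (hqp ▸ hp')
  have hdist : ∀ k i s : ℤ, dist q (barlowPos 1 (Real.sqrt (2 / 3)) constHagg k i (s - i)) ^ 2 =
      (⟪q, e₁⟫_ℝ - ⟪barlowPos 1 (Real.sqrt (2 / 3)) constHagg k i (s - i), e₁⟫_ℝ) ^ 2 +
      (⟪q, e₂⟫_ℝ - ⟪barlowPos 1 (Real.sqrt (2 / 3)) constHagg k i (s - i), e₂⟫_ℝ) ^ 2 +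
      (⟪q, ν⟫_ℝ - (s : ℝ) * c) ^ 2 := by
    intro k i s
    rw [dist_eq_norm, norm_sq_eq_cubeFrame (q - _), inner_sub_left, inner_sub_left, inner_sub_left,
      hη]
  by_cases hup : -(6 * c) < ⟪q, ν⟫_ℝ
  · -- above the top layer `s = -6`
    obtain ⟨k, i, hcov⟩ := exists_cubeSite_planar_sq_le_half q (-6)
    have hmem := hsite k i (-6) (by norm_num) (by norm_num) hcov
    have hsq := cube_hollow_height_sq q (-6) k i hcov (hfar _ hmem)
    push_cast at hsq
    have hpos : 0 < ⟪q, ν⟫_ℝ + 6 * c := by linarith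
    have hge : c ≤ ⟪q, ν⟫_ℝ + 6 * c := by
      by_contra hlt
      have hlt := not_le.1 hlt
      nlinarith [hc2]
    have : c ≤ Φ q := le_trans hge (by rw [hΦ]; exact le_max_left _ _)
    linarith
  by_cases hdown : ⟪q, ν⟫_ℝ < -(11 * c)
  · -- below the bottom layer `s = -11`
    obtain ⟨k, i, hcov⟩ := exists_cubeSite_planar_sq_le_half q (-11)
    have hmem := hsite k i (-11) (by norm_num) (by norm_num) hcov
    have hsq := cube_hollow_height_sq q (-11) k i hcov (hfar _ hmem)
    push_cast at hsq
    have hpos : 0 < -(11 * c) - ⟪q, ν⟫_ℝ := by linarith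
    have hge : c ≤ -(11 * c) - ⟪q, ν⟫_ℝ := by
      by_contra hlt
      have hlt := not_le.1 hlt
      nlinarith [hc2]
    have : c ≤ Φ q := le_trans hge (by rw [hΦ]; exact le_trans (le_max_left _ _) (le_max_right _ _))
    linarith
  · -- inside the slab: the nearest layer is within `c/2`, its covering site within distance `< 1`
    have hup' := not_lt.1 hup
    have hdown' := not_lt.1 hdown
    set s : ℤ := ⌊⟪q, ν⟫_ℝ / c + 1 / 2⌋ with hs
    have hs1 : (s : ℝ) ≤ ⟪q, ν⟫_ℝ / c + 1 / 2 := Int.floor_le _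
    have hs2 : ⟪q, ν⟫_ℝ / c + 1 / 2 < (s : ℝ) + 1 := Int.lt_floor_add_one _
    have hqc : ⟪q, ν⟫_ℝ / c * c = ⟪q, ν⟫_ℝ := div_mul_cancel₀ _ hcpos.ne'
    have hsc : |⟪q, ν⟫_ℝ - (s : ℝ) * c| ≤ c / 2 := by
      rw [abs_le]; constructor
      · have := mul_le_mul_of_nonneg_right hs1 hcpos.le
        rw [add_mul, hqc] at this; linarith
      · have := mul_le_mul_of_nonneg_right hs2.le hcpos.le
        rw [add_mul, add_mul, hqc] at this; linarith
    have hslo : -11 ≤ s := by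
      have h1 : (-11 : ℝ) ≤ ⟪q, ν⟫_ℝ / c := by rw [le_div_iff₀ hcpos]; linarith
      have h2 : (-11 : ℤ) ≤ ⌊⟪q, ν⟫_ℝ / c + 1 / 2⌋ := Int.le_floor.2 (by push_cast; linarith)
      rw [hs]; exact h2
    have hshi : s ≤ -6 := by
      have h1 : ⟪q, ν⟫_ℝ / c ≤ -6 := by rw [div_le_iff₀ hcpos]; linarith
      have h2 : ⌊⟪q, ν⟫_ℝ / c + 1 / 2⌋ < (-6 : ℤ) + 1 := Int.floor_lt.2 (by push_cast; linarith)
      rw [hs]; omega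
    obtain ⟨k, i, hcov⟩ := exists_cubeSite_planar_sq_le_half q s
    have hmem := hsite k i s hslo hshi hcov
    have h1 := hfar _ hmem
    have hzk : (⟪q, ν⟫_ℝ - (s : ℝ) * c) ^ 2 ≤ (c / 2) ^ 2 := by
      rw [← sq_abs]; exact pow_le_pow_left₀ (abs_nonneg _) hsc 2
    have hlt1 : dist q (barlowPos 1 (Real.sqrt (2 / 3)) constHagg k i (s - i)) ^ 2 < 1 := by
      have e : (c / 2) ^ 2 = 1 / 8 := by rw [div_pow, hc2]; norm_num
      rw [hdist]; linarith [hzk.trans_eq e]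
    have hge1 : 1 ≤ dist q (barlowPos 1 (Real.sqrt (2 / 3)) constHagg k i (s - i)) ^ 2 :=
      one_le_pow₀ h1
    linarith

end Summit.Ventures.Crystal3D.Theorems

end
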